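import Summits.MatrixMultiplication.MatrixMultiplication.Theorems.AbelianSTPPCensusFPQThreeStructure

/-!
# Rule FPq at `p = 3` («FP3»): exactness at full classes and the tricolored matching of the no-ones regime

Cell mm-stpp (rung F-M1), theory lane «past the walls» (seat mm-stpp-theory, gen 19).  Census-silent STRUCTURE file, sequel of
`AbelianSTPPCensusFPQThree` / `…Structure` (HOME/mm-stpp-theory/FP3-NOTE.md §8(a), §9: the «type (i)» rows).

At a FULL target class (`W = 3`) the rule is exact: `3·vmin ≤ Σ_g u_g·v_{c−g} ≤ 3·cap` (clauses (F2) and (F1)); when `vmin = cap = β` (all members of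
the list have the same middle size, e.g. `(7,7,7)^k`) the product sum EQUALS `3β`, and splitting it by value pairs
(`three_prod_split`: `Σ u v = 9·n₃₃ + 6·(n₃₂ + n₂₃) + 4·n₂₂ + 3·(n₃₁ + n₁₃) + 2·(n₂₁ + n₁₂) + n₁₁`) turns the full classes into an arithmetic
object.  In the NO-ONES regime (no class of value `1` in the two summands) with `β = 7`: `21 = 9·n₃₃ + 6·(n₃₂ + n₂₃) + 4·n₂₂` forces `n₃₃ = 1`
(`three_fullfull_eq_one_noones`) — every full class sees EXACTLY ONE pair of full classes.  Read across the three letter forms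
(`three_noones_full_matching`): every full class of `x`, `y`, `z` lies in exactly one solution `g + h = c` with all three classes full, so the
all-full solutions are a perfect matching and `#F_x = #F_y = #F_z` — the full classes form a TRICOLORED SUM-FREE triple in `Λ` (the structure the
tree's `Literature/Barriers/MatrixMultiplication/TricoloredSumFree*` files are about, here inside the label group of a hypothetical STPP host).
WHAT THIS IS NOT: no kill, no certificate, no census number, no `ω` statement; statements about the shape-level predicate only.
-/

set_option linter.dupNamespace false -- `MatrixMultiplication.MatrixMultiplication` (summit = problem, D-0017)
set_option autoImplicit false

namespace Summit.MatrixMultiplication.MatrixMultiplication.Theorems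

open Finset

namespace FPQ

variable {Λ : Type} [AddCommGroup Λ] [Fintype Λ]
variable {cap vmin SU SV SW : ℕ} {u v w : Λ → ℕ}

/-! ### The product sum at a target class, split by value pairs -/

/-- `Σ_g u_g·v_{c−g}` split by value pairs (values `≤ 3`):
`= 9·n₃₃ + 6·n₃₂ + 6·n₂₃ + 4·n₂₂ + 3·n₃₁ + 3·n₁₃ + 2·n₂₁ + 2·n₁₂ + n₁₁`, `n_ab = #{g : u_g = a ∧ v_{c−g} = b}`. [bookkeeping] -/
theorem three_prod_split (hu : ∀ g, u g ≤ 3) (hv : ∀ g, v g ≤ 3) (c : Λ) :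
    ∑ g, u g * v (c - g) =
      9 * (univ.filter (fun g => u g = 3 ∧ v (c - g) = 3)).card + 6 * (univ.filter (fun g => u g = 3 ∧ v (c - g) = 2)).card +
      6 * (univ.filter (fun g => u g = 2 ∧ v (c - g) = 3)).card + 4 * (univ.filter (fun g => u g = 2 ∧ v (c - g) = 2)).card +
      3 * (univ.filter (fun g => u g = 3 ∧ v (c - g) = 1)).card + 3 * (univ.filter (fun g => u g = 1 ∧ v (c - g) = 3)).card +
      2 * (univ.filter (fun g => u g = 2 ∧ v (c - g) = 1)).card + 2 * (univ.filter (fun g => u g = 1 ∧ v (c - g) = 2)).card +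
      (univ.filter (fun g => u g = 1 ∧ v (c - g) = 1)).card := by
  simp only [card_filter, mul_sum, ← sum_add_distrib]
  refine sum_congr rfl fun g _ => ?_
  have key : ∀ a ≤ 3, ∀ b ≤ 3, a * b =
      9 * (if a = 3 ∧ b = 3 then 1 else 0) + 6 * (if a = 3 ∧ b = 2 then 1 else 0) + 6 * (if a = 2 ∧ b = 3 then 1 else 0) +
      4 * (if a = 2 ∧ b = 2 then 1 else 0) + 3 * (if a = 3 ∧ b = 1 then 1 else 0) + 3 * (if a = 1 ∧ b = 3 then 1 else 0) +
      2 * (if a = 2 ∧ b = 1 then 1 else 0) + 2 * (if a = 1 ∧ b = 2 then 1 else 0) + (if a = 1 ∧ b = 1 then 1 else 0) := by decide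
  exact key (u g) (hu g) (v (c - g)) (hv (c - g))

omit [Fintype Λ] in
/-- A value-pair count with a forbidden value is zero. [bookkeeping] -/
theorem card_pairs_eq_zero_left [Fintype Λ] {a b : ℕ} (hu : ∀ g, u g ≠ a) (c : Λ) :
    (univ.filter (fun g => u g = a ∧ v (c - g) = b)).card = 0 :=
  card_eq_zero.mpr (filter_eq_empty_iff.mpr fun g _ h => hu g h.1)

omit [Fintype Λ] in
/-- A value-pair count with a forbidden value (second summand) is zero. [bookkeeping] -/
theorem card_pairs_eq_zero_right [Fintype Λ] {a b : ℕ} (hv : ∀ g, v g ≠ b) (c : Λ) :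
    (univ.filter (fun g => u g = a ∧ v (c - g) = b)).card = 0 :=
  card_eq_zero.mpr (filter_eq_empty_iff.mpr fun g _ h => hv (c - g) h.2)

/-! ### Exactness at a full class -/

/-- **A full target class pins the product sum**: `3·vmin ≤ Σ_g u_g·v_{c−g} ≤ 3·cap`. [original] -/
theorem three_full_prod_bounds {c : Λ} (hT : TargetOKG Λ 3 cap vmin u v c 3) (hu : ∀ g, u g ≤ 3) (hv : ∀ g, v g ≤ 3) :
    vmin * 3 ≤ ∑ g, u g * v (c - g) ∧ ∑ g, u g * v (c - g) ≤ 3 * cap :=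
  ⟨hT.2.2.1, three_prod_sum_le_of_full hT hu hv⟩

/-- **No-ones regime, `vmin = cap = 7`: a full class sees exactly ONE pair of full classes.**  With no class of value `1` in `u` or `v`,
`21 = 9·n₃₃ + 6·(n₃₂ + n₂₃) + 4·n₂₂` has `n₃₃ = 1` as its only solution in naturals. [original] -/
theorem three_fullfull_eq_one_noones {c : Λ} (hT : TargetOKG Λ 3 7 7 u v c 3) (hu : ∀ g, u g ≤ 3) (hv : ∀ g, v g ≤ 3)
    (hu1 : ∀ g, u g ≠ 1) (hv1 : ∀ g, v g ≠ 1) :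
    (univ.filter (fun g => u g = 3 ∧ v (c - g) = 3)).card = 1 := by
  obtain ⟨hlo, hhi⟩ := three_full_prod_bounds hT hu hv
  rw [three_prod_split hu hv c] at hlo hhi
  have h31 := card_pairs_eq_zero_right (u := u) (a := 3) hv1 c
  have h13 := card_pairs_eq_zero_left (v := v) (b := 3) hu1 c
  have h21 := card_pairs_eq_zero_right (u := u) (a := 2) hv1 c
  have h12 := card_pairs_eq_zero_left (v := v) (b := 2) hu1 c
  have h11 := card_pairs_eq_zero_left (v := v) (b := 1) hu1 c
  rw [h31, h13, h21, h12, h11] at hlo hhi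
  omega

/-! ### The tricolored matching of the no-ones regime (three forms, all caps and lower bounds `7`) -/

variable {SX SY : ℕ} {x y z : Λ → ℕ}

/-- **Tricolored matching.**  Three letter forms at `p = 3` with `cap = vmin = 7` everywhere (lists `(7,7,7)^k`), no class of value `1` in any
letter.  Then (B) every full class `c` of `z` has exactly one `g` with `x_g = 3`, `y_{c−g} = 3`; (A) every full class `d` of `y` has exactly one `h`
with `z_h = 3`, `x_{h−d} = 3`; (C) every full class `d` of `x` has exactly one `g` with `y_g = 3`, `z_{g+d} = 3`.  Consequently the all-full solutions
`g + h = c` form a perfect matching between `F_x`, `F_y`, `F_z`, and `#F_x = #F_z`, `#F_y = #F_z` (`three_noones_card_full_eq`). [original] -/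
theorem three_noones_full_matching
    (hB : FormOKG Λ 3 7 7 SX SY SW x y z)
    (hA : FormOKG Λ 3 7 7 SW SX SY (fun g => z (-g)) x (fun g => y (-g)))
    (hC : FormOKG Λ 3 7 7 SY SW SX y (fun g => z (-g)) (fun g => x (-g)))
    (hx1 : ∀ g, x g ≠ 1) (hy1 : ∀ g, y g ≠ 1) (hz1 : ∀ g, z g ≠ 1) :
    (∀ c, z c = 3 → (univ.filter (fun g => x g = 3 ∧ y (c - g) = 3)).card = 1) ∧
    (∀ d, y d = 3 → (univ.filter (fun h => z h = 3 ∧ x (h - d) = 3)).card = 1) ∧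
    (∀ d, x d = 3 → (univ.filter (fun g => y g = 3 ∧ z (g + d) = 3)).card = 1) := by
  have hx3 : ∀ g, x g ≤ 3 := hB.2.2.2.1
  have hy3 : ∀ g, y g ≤ 3 := hB.2.2.2.2.1
  have hz3 : ∀ g, z g ≤ 3 := fun g => three_target_le hB g
  refine ⟨fun c hc => ?_, fun d hd => ?_, fun d hd => ?_⟩
  · have hT := hB.2.2.2.2.2 c
    rw [hc] at hT
    exact three_fullfull_eq_one_noones hT hx3 hy3 hx1 hy1
  · -- form A at the target class `−d`: pairs `(z (−g), x (−d − g))`; re-index `h = −g`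
    have hT : TargetOKG Λ 3 7 7 (fun g => z (-g)) x (-d) 3 := by
      have h0 := hA.2.2.2.2.2 (-d)
      dsimp only at h0
      rw [neg_neg, hd] at h0
      exact h0
    have h1 := three_fullfull_eq_one_noones (u := fun g => z (-g)) (v := x) hT (fun g => hz3 (-g)) hx3 (fun g => hz1 (-g)) hx1
    rw [← h1, card_filter, card_filter]
    conv_rhs => rw [← Equiv.sum_comp (Equiv.neg Λ)]
    refine sum_congr rfl fun h _ => ?_
    simp only [Equiv.neg_apply, neg_neg, sub_neg_eq_add]
    rw [neg_add_eq_sub]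
  · -- form C at the target class `−d`: pairs `(y g, z (−(−d − g))) = (y g, z (g + d))`
    have hT : TargetOKG Λ 3 7 7 y (fun g => z (-g)) (-d) 3 := by
      have h0 := hC.2.2.2.2.2 (-d)
      dsimp only at h0
      rw [neg_neg, hd] at h0
      exact h0
    have h1 := three_fullfull_eq_one_noones (u := y) (v := fun g => z (-g)) hT hy3 (fun g => hz3 (-g)) hy1 (fun g => hz1 (-g))
    rw [← h1]
    refine congrArg card (filter_congr fun g _ => ?_)
    rw [neg_sub, sub_neg_eq_add]

/-- **Equal numbers of full classes** in the no-ones regime (double counting the matching of `three_noones_full_matching`):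
`#F_x = #F_z` and `#F_y = #F_z`. [original] -/
theorem three_noones_card_full_eq
    (hB : FormOKG Λ 3 7 7 SX SY SW x y z)
    (hA : FormOKG Λ 3 7 7 SW SX SY (fun g => z (-g)) x (fun g => y (-g)))
    (hC : FormOKG Λ 3 7 7 SY SW SX y (fun g => z (-g)) (fun g => x (-g)))
    (hx1 : ∀ g, x g ≠ 1) (hy1 : ∀ g, y g ≠ 1) (hz1 : ∀ g, z g ≠ 1) :
    (univ.filter (fun g => x g = 3)).card = (univ.filter (fun c => z c = 3)).card ∧
    (univ.filter (fun h => y h = 3)).card = (univ.filter (fun c => z c = 3)).card := by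
  classical
  obtain ⟨hBm, hAm, hCm⟩ := three_noones_full_matching hB hA hC hx1 hy1 hz1
  -- `T = Σ_g Σ_h [x g = 3 ∧ y h = 3 ∧ z (g + h) = 3]`, counted three ways
  set T := ∑ g, ∑ h, (if x g = 3 ∧ y h = 3 ∧ z (g + h) = 3 then 1 else 0) with hTdef
  -- by `g` (form C): for `x g = 3` the inner sum is `1`, else `0`
  have hTx : T = (univ.filter (fun g => x g = 3)).card := by
    rw [hTdef, card_filter]
    refine sum_congr rfl fun g _ => ?_
    by_cases hg : x g = 3
    · rw [if_pos hg]
      conv_rhs => rw [← hCm g hg, card_filter]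
      refine sum_congr rfl fun h _ => ?_
      by_cases hh : y h = 3 ∧ z (h + g) = 3
      · rw [if_pos hh, if_pos ⟨hg, hh.1, by rw [add_comm]; exact hh.2⟩]
      · rw [if_neg hh, if_neg (fun h' => hh ⟨h'.2.1, by rw [add_comm]; exact h'.2.2⟩)]
    · rw [if_neg hg]
      exact sum_eq_zero fun h _ => if_neg (fun h' => hg h'.1)
  -- by `h` (form A): for `y h = 3` the inner sum over `g` is `1` (re-index `g' = g + h`)
  have hTy : T = (univ.filter (fun h => y h = 3)).card := by
    rw [hTdef, sum_comm, card_filter]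
    refine sum_congr rfl fun h _ => ?_
    by_cases hh : y h = 3
    · rw [if_pos hh]
      conv_rhs => rw [← hAm h hh, card_filter, ← Equiv.sum_comp (Equiv.addRight h)]
      refine sum_congr rfl fun g _ => ?_
      simp only [Equiv.coe_addRight, add_sub_cancel_right]
      by_cases hg : x g = 3 ∧ z (g + h) = 3
      · rw [if_pos ⟨hg.1, hh, hg.2⟩, if_pos ⟨hg.2, hg.1⟩]
      · rw [if_neg (fun h' => hg ⟨h'.1, h'.2.2⟩), if_neg (fun h' => hg ⟨h'.2, h'.1⟩)]
    · rw [if_neg hh]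
      exact sum_eq_zero fun g _ => if_neg (fun h' => hh h'.2.1)
  -- by `c = g + h` (form B): re-index the inner sum, swap, for `z c = 3` the inner sum is `1`
  have hTz : T = (univ.filter (fun c => z c = 3)).card := by
    rw [hTdef]
    have hre : ∀ g, ∑ h, (if x g = 3 ∧ y h = 3 ∧ z (g + h) = 3 then 1 else 0) =
        ∑ c, (if x g = 3 ∧ y (c - g) = 3 ∧ z c = 3 then 1 else 0) := fun g => by
      conv_rhs => rw [← Equiv.sum_comp (Equiv.addLeft g)]
      simp only [Equiv.coe_addLeft, add_sub_cancel_left]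
    rw [sum_congr rfl (fun g _ => hre g), sum_comm, card_filter]
    refine sum_congr rfl fun c _ => ?_
    by_cases hc : z c = 3
    · rw [if_pos hc]
      conv_rhs => rw [← hBm c hc, card_filter]
      refine sum_congr rfl fun g _ => ?_
      by_cases hg : x g = 3 ∧ y (c - g) = 3
      · rw [if_pos hg, if_pos ⟨hg.1, hg.2, hc⟩]
      · rw [if_neg hg, if_neg (fun h' => hg ⟨h'.1, h'.2.1⟩)]
    · rw [if_neg hc]
      exact sum_eq_zero fun g _ => if_neg (fun h' => hc h'.2.2)
  exact ⟨hTx.symm.trans hTz, hTy.symm.trans hTz⟩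

end FPQ

end Summit.MatrixMultiplication.MatrixMultiplication.Theorems
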